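import Summits.HodgeConjecture.HodgeConjecture.Theorems.F0P3ClassTokensOfRecord          -- ★ p819048 (p04 (g6)): `Cls`, `cl`, `rep`, `mult`, `cl_eq_cl_iff`, `multiplicity_congr_right`, `exists_mem_areUnitarilyEquivalent_of_decomposition`
import Literature.NumberTheory.Automorphic.AutomorphicQuotientSpectralExpansionPolar       -- ★ `diagTrace_hasSum_multiplicity_mul_tsum_inner`, `ClosedSubrep.tsum_inner_integratedOperator_eq_of_areUnitarilyEquivalent`, HS summability
import Literature.NumberTheory.Automorphic.AdelicUnitaryGroupSpectrum                       -- ★ `isDiscretelyDecomposable_rightRegular_cmDatum` (`L²` of the compact quotient is a Hilbert sum of irreducibles)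
import HarnessLib

/-!
# Crux `H413` — T5 ED. 4, C-package: the CLASS TRACE of record `trGp₀ c F′ = Σ_k ⟪e^c_k, R(F′) e^c_k⟫` and the law `SpectralSideGp` at 𝔠₀
# ON THE CONVOLUTION SPAN: `θ_{G′}(g ⋆ h^*) = Σ_{c ∈ Cls₀} mult₀ c · trGp₀ c (g ⋆ h^*)` (Rogawski §14.5 «`T_{G′}(f′) = Σ_{π′} m(π′) tr π′(f′)`»)

F0∕P3 «U3-mult», cell `hodgecm-mathlib`, crux H413 (`stmt-HodgeConjecture-24833`); integrator T5 v5 (`Cruxes/H413/Lines/F0_T5InnerFormClassification.lean`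
94e361441a4b; ★ V5-A p820470, V5-B `SpectralSideGp` :54), PLAN.F0P3g5 §1 row 2 ∕ §5 K3, RULING (V33)(5); p04 (g7) census `CENSUS-C-pkg.F0P3p04g7.md` item 5.
The kit posits `trGp : Cls → TestGp → ℂ` («`tr π′(f′)`») and the law `SpectralSideGp`: `traceGp (tens S fS fT) = Σ' c, mult c · trGp c (tens S fS fT)` (summable).
At 𝔠₀: `Cls := Cls (Gp L H) μ`, `mult := mult …` (★ p819048), `traceGp :=` T1's socket, pinned to ★ `UnitaryGroup.diagTrace L 3 H μ ν hanis` (T1 pin (i)∕(v)).  THIS FILE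
supplies the class trace and the law's instance on print's convolution span [Gelbart1975 (9.11): «at least when `f = f₁ * f₂`»]:
* §1 (generic `𝒢 : AdelicGroupData K`) `clsBasis c` — a CHOSEN Hilbert basis of `(rep c).space` (Mathlib `exists_hilbertBasis`); **`trGp₀ ν c F := Σ' k, ⟪e^c_k, R(F) e^c_k⟫_ℂ`**,
  `R(F) = (𝒢.rightRegular μ).integratedOperator … ν F` (★ `IntegratedOperator`) — «`tr π′(F)`» read along the chosen basis of the representative of the class.
* §2 (generic, compact quotient) `tsum_inner_integratedOperator_self_eq_pairing` — ON A CLOSED INVARIANT BLOCK `W` and for `F = g ⋆ h^*`: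
  `Σ_k ⟪e_k, R(F) e_k⟫ = Σ_k ⟪R(h) e_k, R(g) e_k⟫` along every Hilbert basis of `W` (adjoint form of the Hilbert–Schmidt pairing ★ `hasSum_inner_apply_apply_and_adjoint`
  inside `W`, with `R(F)|_W = R(g)|_W ∘ (R(h)|_W)^†` from ★ `integratedOperator_comp_integratedOperator` + ★ `adjoint_integratedOperator`); `trGp₀_eq_pairing_of_areUnitarilyEquivalent`
  — the class term of ★ `diagTrace_hasSum_multiplicity_mul_tsum_inner` at ANY member `W ≃ rep c` of a decomposition IS `trGp₀ c F` (★ `tsum_inner_integratedOperator_eq_of_areUnitarilyEquivalent`).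
* §3 **`hasSum_mult_mul_trGp₀`** (generic) and **`spectralSideGp₀_of_conv`** (`G′ = U(H)`, `H` anisotropic; frame form `…_of_frame` under `hdef`, `h2`):
  `Summable (c ↦ mult c · trGp₀ c F) ∧ UnitaryGroup.diagTrace … F = Σ' c, mult c · trGp₀ c F` for `F = g ⋆ h^*` — the law `SpectralSideGp` at 𝔠₀ on the convolution
  span, from ★ `diagTrace_hasSum_multiplicity_mul_tsum_inner` over the decomposition of `L²` into irreducibles that EXISTS (★ `isDiscretelyDecomposable_rightRegular_cmDatum`
  + ★ `exists_orthogonalDecomposition_of_isDiscretelyDecomposable`), regrouped along `q := cl` (★ `cl_eq_cl_iff`; `range q =` all of `Cls₀` by ★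
  `exists_mem_areUnitarilyEquivalent_of_decomposition`; multiplicities transported by ★ `multiplicity_congr_right`).
NOT here (census item 5, planner's word (a)∕(b)): general smooth `f′` (Dixmier–Malliavin ∕ trace class) — the law for arbitrary `tens S fS fT` is either kept as a law or the
arch test factor is cut to the convolution span.  Definitions with bodies (`clsBasisIdx`, `clsBasis`, `trGp₀`) + theorems; no `sorry`, no named fact, no instance, no notation.
`--supports stmt-HodgeConjecture-24833 --as helper`.  HONEST LABEL: HC_CM is proved only modulo the printed citations until rung 0 closes.

References: [Rogawski1990] §14.5 p. 237; [Gelbart1975] (9.11), Lemma 10.6, (10.12)–(10.14); [ReedSimon1972] Thm. VI.22 (e), VI.24; [Dixmier1977] 5.4.1, 5.4.6;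
[DeitmarEchterhoff2014] Thm. 9.2.2.
-/

set_option autoImplicit false
-- the mandated namespace repeats `HodgeConjecture.HodgeConjecture`, as in every `Theorems/*.lean` of this sub-problem
set_option linter.dupNamespace false

noncomputable section

open MeasureTheory Measure NumberField CompactlySupported
open ContRepresentation
open Literature.NumberTheory.Automorphic Literature.Analysis.OperatorTheory
open scoped InnerProductSpace ComplexConjugate

namespace Summit.HodgeConjecture.HodgeConjecture.Cruxes.H413.F0P3SpectralSideOfRecord

open Summit.HodgeConjecture.HodgeConjecture.Cruxes.H413.F0P3ClassTokensOfRecord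
  (Cls cl rep mult cl_eq_cl_iff cl_rep cl_surjective rep_cl_areUnitarilyEquivalent multiplicity_congr_right exists_mem_areUnitarilyEquivalent_of_decomposition)

universe u

/-! ## §1 The class trace of record `trGp₀` (generic adelic group datum) -/

section Generic

variable {K : Type} [Field K] [NumberField K] (𝒢 : AdelicGroupData.{u} K)
  (μ : Measure 𝒢.automorphicQuotient) [𝒢.IsAutomorphicMeasure μ]
  [MeasurableSpace 𝒢.Adelic] [BorelSpace 𝒢.Adelic]
  (ν : Measure 𝒢.Adelic) [IsFiniteMeasureOnCompacts ν]

/-- The index set of the CHOSEN Hilbert basis of the representative `rep c` of a class (Mathlib `exists_hilbertBasis`). -/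
def clsBasisIdx (c : Cls 𝒢 μ) : Set ((rep 𝒢 μ c).space.toSubmodule) :=
  (exists_hilbertBasis ℂ ((rep 𝒢 μ c).space.toSubmodule)).choose

/-- **A CHOSEN Hilbert basis `(e^c_k)` of `(rep c).space`** (closed invariant irreducible subspace of `L²(X, μ)`; Mathlib `exists_hilbertBasis`). -/
def clsBasis (c : Cls 𝒢 μ) : HilbertBasis (clsBasisIdx 𝒢 μ c) ℂ ((rep 𝒢 μ c).space.toSubmodule) :=
  (exists_hilbertBasis ℂ ((rep 𝒢 μ c).space.toSubmodule)).choose_spec.choose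

/-- **The class trace of record `trGp₀ c F := Σ' k, ⟪e^c_k, R(F) e^c_k⟫`** — «`tr π′(F)`» [Rogawski1990 §14.5 p. 237] read as the DIAGONAL SUM of
`R(F) = ∫ F(g) R(g) dν(g)` (★ `ContRepresentation.integratedOperator`) along the chosen Hilbert basis of the representative of the class `π′ = c`.  On the
convolution span `F = g ⋆ h^*` it is the Hilbert–Schmidt pairing of the blocks `R(g)|`, `R(h)|` of ANY member of the class (§2), hence basis- and
representative-free there. [cite: Rogawski1990, §14.5 p. 237] [cite: Gelbart1975, (9.11) and (10.14)] -/
def trGp₀ (c : Cls 𝒢 μ) (F : C_c(𝒢.Adelic, ℂ)) : ℂ :=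
  ∑' k, ⟪((clsBasis 𝒢 μ c k : (rep 𝒢 μ c).space.toSubmodule) : 𝒢.L2 μ),
    (𝒢.rightRegular μ).integratedOperator (𝒢.isUnitary_rightRegular μ) (𝒢.isStronglyContinuous_rightRegular_holds μ) ν F
      ((clsBasis 𝒢 μ c k : (rep 𝒢 μ c).space.toSubmodule) : 𝒢.L2 μ)⟫_ℂ

/-- Unfolding `trGp₀`. -/
theorem trGp₀_def (c : Cls 𝒢 μ) (F : C_c(𝒢.Adelic, ℂ)) : trGp₀ 𝒢 μ ν c F =
    ∑' k, ⟪((clsBasis 𝒢 μ c k : (rep 𝒢 μ c).space.toSubmodule) : 𝒢.L2 μ),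
      (𝒢.rightRegular μ).integratedOperator (𝒢.isUnitary_rightRegular μ) (𝒢.isStronglyContinuous_rightRegular_holds μ) ν F
        ((clsBasis 𝒢 μ c k : (rep 𝒢 μ c).space.toSubmodule) : 𝒢.L2 μ)⟫_ℂ := rfl

end Generic

/-! ## §2 On a block: diagonal sum of `R(g ⋆ h^*)` = Hilbert–Schmidt pairing of `R(h)|_W`, `R(g)|_W` (compact quotient) -/

section Block

variable {K : Type} [Field K] [NumberField K] (𝒢 : AdelicGroupData.{u} K)
  (μ : Measure 𝒢.automorphicQuotient) [𝒢.IsAutomorphicMeasure μ]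
  [LocallyCompactSpace 𝒢.Adelic] [SecondCountableTopology 𝒢.Adelic] [T2Space 𝒢.Adelic]
  [MeasurableSpace 𝒢.Adelic] [BorelSpace 𝒢.Adelic]
  [hH : IsClosed (𝒢.quotientSubgroup : Set 𝒢.Adelic)]
  (ρ : Measure 𝒢.quotientSubgroup) [ρ.IsMulLeftInvariant] [ρ.IsMulRightInvariant] [ρ.IsInvInvariant]
  [IsFiniteMeasureOnCompacts ρ] [SFinite ρ]
  (ν : Measure 𝒢.Adelic) [IsHaarMeasure ν] [ν.IsInvInvariant]

omit [LocallyCompactSpace 𝒢.Adelic] [SecondCountableTopology 𝒢.Adelic] [T2Space 𝒢.Adelic] hH in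
/-- **The adjoint of `R(h)|_W` inside the block is `R(h^*)|_W`** (`W` closed invariant; ★ `adjoint_integratedOperator` on `L²`, compressed). [folklore]
[cite: ReedSimon1972, Thm. VI.24] -/
theorem adjoint_integratedOperatorRestrict (W : ClosedSubrep (𝒢.rightRegular μ)) (h hs : C_c(𝒢.Adelic, ℂ)) (hhs : ∀ x, hs x = mulStar (⇑h) x) :
    ContinuousLinearMap.adjoint (W.integratedOperatorRestrict (𝒢.isUnitary_rightRegular μ) (𝒢.isStronglyContinuous_rightRegular_holds μ) ν h) =
      W.integratedOperatorRestrict (𝒢.isUnitary_rightRegular μ) (𝒢.isStronglyContinuous_rightRegular_holds μ) ν hs := by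
  have hu := 𝒢.isUnitary_rightRegular μ
  have hc := 𝒢.isStronglyContinuous_rightRegular_holds μ
  have hadj := ContRepresentation.adjoint_integratedOperator hu hc ν h hs hhs
  symm
  rw [ContinuousLinearMap.eq_adjoint_iff]
  intro v w
  rw [Submodule.coe_inner, Submodule.coe_inner, ClosedSubrep.coe_integratedOperatorRestrict_apply,
    ClosedSubrep.coe_integratedOperatorRestrict_apply, ← hadj, ContinuousLinearMap.adjoint_inner_left]

/-- **On a closed invariant block `W`, for `F = g ⋆ h^*`: `Σ_k ⟪e_k, R(F) e_k⟫ = Σ_k ⟪R(h) e_k, R(g) e_k⟫` along every Hilbert basis `(e_k)` of `W`**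
(both series converge).  `R(F)|_W = R(g)|_W ∘ (R(h)|_W)^†` (★ `integratedOperator_comp_integratedOperator`, the block adjoint above), and the adjoint form of the
Hilbert–Schmidt pairing ★ `hasSum_inner_apply_apply_and_adjoint` INSIDE `W` (`Σ_k ⟪B e_k, A e_k⟫ = Σ_k ⟪A^† e_k, B^† e_k⟫`); Hilbert–Schmidt summability of the blocks from
★ `summable_norm_sq_integratedOperator_rightRegular_of_orthonormal`. [cite: Gelbart1975, (9.11) and (10.12)] [cite: ReedSimon1972, Thm. VI.22 (e) and VI.24] -/
theorem hasSum_inner_integratedOperator_self_block [CompactSpace 𝒢.automorphicQuotient] (hρ : ρ ≠ 0)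
    (g h F : C_c(𝒢.Adelic, ℂ)) (hF : ∀ x, F x = mulConv ν (⇑g) (mulStar (⇑h)) x)
    (W : ClosedSubrep (𝒢.rightRegular μ)) {ι : Type*} (b : HilbertBasis ι ℂ W.toSubmodule) :
    HasSum (fun k => ⟪((b k : W.toSubmodule) : 𝒢.L2 μ),
        (𝒢.rightRegular μ).integratedOperator (𝒢.isUnitary_rightRegular μ) (𝒢.isStronglyContinuous_rightRegular_holds μ) ν F
          ((b k : W.toSubmodule) : 𝒢.L2 μ)⟫_ℂ)
      (∑' k, ⟪(𝒢.rightRegular μ).integratedOperator (𝒢.isUnitary_rightRegular μ) (𝒢.isStronglyContinuous_rightRegular_holds μ) ν h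
            ((b k : W.toSubmodule) : 𝒢.L2 μ),
          (𝒢.rightRegular μ).integratedOperator (𝒢.isUnitary_rightRegular μ) (𝒢.isStronglyContinuous_rightRegular_holds μ) ν g
            ((b k : W.toSubmodule) : 𝒢.L2 μ)⟫_ℂ) := by
  have hu := 𝒢.isUnitary_rightRegular μ
  have hc := 𝒢.isStronglyContinuous_rightRegular_holds μ
  -- `h^*` in `C_c`, `R(h)|_W ^† = R(h^*)|_W`, `R(g) ∘ R(h^*) = R(F)`
  obtain ⟨hs, hhs⟩ := exists_compactlySupported_mulStar h
  have hadjW := adjoint_integratedOperatorRestrict 𝒢 μ ν W h hs hhs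
  have hcomp := ContRepresentation.integratedOperator_comp_integratedOperator hu hc ν g hs F fun x => by
    rw [hF x, show (⇑hs : 𝒢.Adelic → ℂ) = mulStar (⇑h) from funext hhs]
  -- the member basis is an orthonormal family of `L²`: Hilbert–Schmidt summability of the blocks
  have hv : Orthonormal ℂ (fun k => ((b k : W.toSubmodule) : 𝒢.L2 μ)) := W.toSubmodule.subtypeₗᵢ.orthonormal_comp_iff.mpr b.orthonormal
  have hsg := 𝒢.summable_norm_sq_integratedOperator_rightRegular_of_orthonormal μ ρ ν hρ g hv
  have hsh := 𝒢.summable_norm_sq_integratedOperator_rightRegular_of_orthonormal μ ρ ν hρ h hv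
  -- the compressed operators on the Hilbert space `W`
  set Ag := W.integratedOperatorRestrict hu hc ν g with hAg
  set Ah := W.integratedOperatorRestrict hu hc ν h with hAh
  have hsg' : Summable fun k => ‖Ag (b k)‖ ^ 2 := by
    simpa only [hAg, ← Submodule.norm_coe, ClosedSubrep.coe_integratedOperatorRestrict_apply] using hsg
  have hsh' : Summable fun k => ‖Ah (b k)‖ ^ 2 := by
    simpa only [hAh, ← Submodule.norm_coe, ClosedSubrep.coe_integratedOperatorRestrict_apply] using hsh
  obtain ⟨s, h1, h2⟩ := hasSum_inner_apply_apply_and_adjoint b b Ah Ag hsh' hsg'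
  -- `h1`: the pairing inside `W` = the pairing in `L²`
  have h1' : HasSum (fun k => ⟪(𝒢.rightRegular μ).integratedOperator hu hc ν h ((b k : W.toSubmodule) : 𝒢.L2 μ),
      (𝒢.rightRegular μ).integratedOperator hu hc ν g ((b k : W.toSubmodule) : 𝒢.L2 μ)⟫_ℂ) s := by
    refine h1.congr_fun fun k => ?_
    rw [hAh, hAg, Submodule.coe_inner, ClosedSubrep.coe_integratedOperatorRestrict_apply, ClosedSubrep.coe_integratedOperatorRestrict_apply]
  rw [h1'.tsum_eq]
  -- `h2`: `⟪Ag^† e_k, Ah^† e_k⟫ = ⟪e_k, Ag (Ah^† e_k)⟫ = ⟪e_k, R(g) (R(h^*) e_k)⟫ = ⟪e_k, R(F) e_k⟫`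
  refine h2.congr_fun fun k => ?_
  rw [ContinuousLinearMap.adjoint_inner_left, hadjW, Submodule.coe_inner, hAg, ClosedSubrep.coe_integratedOperatorRestrict_apply,
    ClosedSubrep.coe_integratedOperatorRestrict_apply, ← hcomp, ContinuousLinearMap.comp_apply]

/-- **The class term is `trGp₀`**: for `F = g ⋆ h^*` and ANY closed invariant `W` unitarily equivalent to `(rep c).space`, along ANY Hilbert basis `(e_k)` of `W`,
`Σ_k ⟪R(h) e_k, R(g) e_k⟫ = trGp₀ c F` (the pairing is a class function ★ `ClosedSubrep.tsum_inner_integratedOperator_eq_of_areUnitarilyEquivalent`, then §2 on the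
block `(rep c).space`). [cite: Rogawski1990, §14.5 p. 237] [cite: Gelbart1975, (10.14)] [cite: Dixmier1977, 5.4.6] -/
theorem tsum_inner_pairing_eq_trGp₀ [CompactSpace 𝒢.automorphicQuotient] (hρ : ρ ≠ 0)
    (g h F : C_c(𝒢.Adelic, ℂ)) (hF : ∀ x, F x = mulConv ν (⇑g) (mulStar (⇑h)) x) (c : Cls 𝒢 μ)
    (W : ClosedSubrep (𝒢.rightRegular μ)) (hW : AreUnitarilyEquivalent W.toContRep (rep 𝒢 μ c).space.toContRep)
    {ι : Type*} (b : HilbertBasis ι ℂ W.toSubmodule) :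
    ∑' k, ⟪(𝒢.rightRegular μ).integratedOperator (𝒢.isUnitary_rightRegular μ) (𝒢.isStronglyContinuous_rightRegular_holds μ) ν h
          ((b k : W.toSubmodule) : 𝒢.L2 μ),
        (𝒢.rightRegular μ).integratedOperator (𝒢.isUnitary_rightRegular μ) (𝒢.isStronglyContinuous_rightRegular_holds μ) ν g
          ((b k : W.toSubmodule) : 𝒢.L2 μ)⟫_ℂ = trGp₀ 𝒢 μ ν c F := by
  have hu := 𝒢.isUnitary_rightRegular μ
  have hc := 𝒢.isStronglyContinuous_rightRegular_holds μ
  -- move the pairing to the chosen basis of `(rep c).space`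
  have hv : Orthonormal ℂ (fun k => ((b k : W.toSubmodule) : 𝒢.L2 μ)) := W.toSubmodule.subtypeₗᵢ.orthonormal_comp_iff.mpr b.orthonormal
  have hsg := 𝒢.summable_norm_sq_integratedOperator_rightRegular_of_orthonormal μ ρ ν hρ g hv
  have hsh := 𝒢.summable_norm_sq_integratedOperator_rightRegular_of_orthonormal μ ρ ν hρ h hv
  rw [← ClosedSubrep.tsum_inner_integratedOperator_eq_of_areUnitarilyEquivalent hu hc ν g h hW b (clsBasis 𝒢 μ c) hsg hsh]
  -- on the block `(rep c).space`: pairing = diagonal sum of `R(F)`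
  exact ((hasSum_inner_integratedOperator_self_block 𝒢 μ ρ ν hρ g h F hF (rep 𝒢 μ c).space (clsBasis 𝒢 μ c)).tsum_eq).symm

/-! ## §3 `θ(g ⋆ h^*) = Σ_{c} mult c · trGp₀ c (g ⋆ h^*)` over the classes of record -/

/-- **`SpectralSideGp` on the convolution span, generic compact quotient**: for `F = g ⋆ h^*`, GIVEN an orthogonal decomposition `S` of `L²(X, μ)` into irreducibles with
dense span, `HasSum (c ↦ mult c · trGp₀ c F) (θ(F))` over ALL classes of record `c : Cls 𝒢 μ` (★ `diagTrace_hasSum_multiplicity_mul_tsum_inner` with `q := cl`,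
whose range is all of `Cls` by ★ `exists_mem_areUnitarilyEquivalent_of_decomposition`; multiplicity and class term transported along `W ≃ rep c`).
[cite: Rogawski1990, §14.5 p. 237] [cite: Gelbart1975, (10.14)] [cite: Dixmier1977, 5.4.6] -/
theorem hasSum_mult_mul_trGp₀ [CompactSpace 𝒢.automorphicQuotient] (hρ : ρ ≠ 0)
    (g h F : C_c(𝒢.Adelic, ℂ)) (hF : ∀ x, F x = mulConv ν (⇑g) (mulStar (⇑h)) x)
    {S : Set (ClosedSubrep (𝒢.rightRegular μ))} (hirr : ∀ W ∈ S, W.toContRep.IsTopIrreducible)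
    (horth : S.Pairwise fun W W' => W.toSubmodule ⟂ W'.toSubmodule) (hdense : ClosedSubrep.iSupClosure S = ⊤) :
    HasSum (fun c : Cls 𝒢 μ => (mult 𝒢 μ c : ℂ) * trGp₀ 𝒢 μ ν c F) (𝒢.diagTrace μ ρ ν F) := by
  classical
  -- member bases, the classifying map `q := cl`, representatives
  have b : ∀ W : S, HilbertBasis (exists_hilbertBasis ℂ (W : ClosedSubrep (𝒢.rightRegular μ)).toSubmodule).choose ℂ
      (W : ClosedSubrep (𝒢.rightRegular μ)).toSubmodule := fun W => (exists_hilbertBasis ℂ _).choose_spec.choose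
  let q : S → Cls 𝒢 μ := fun W => cl 𝒢 μ ⟨W, hirr W W.2⟩
  have hq : ∀ W W' : S, q W = q W' ↔ AreUnitarilyEquivalent (W : ClosedSubrep (𝒢.rightRegular μ)).toContRep
      (W' : ClosedSubrep (𝒢.rightRegular μ)).toContRep := fun W W' => cl_eq_cl_iff 𝒢 μ _ _
  let rp : Set.range q → S := fun c => c.2.choose
  have hrp : ∀ c, q (rp c) = c := fun c => c.2.choose_spec
  have hsum := 𝒢.diagTrace_hasSum_multiplicity_mul_tsum_inner μ ρ ν hρ g h F hF hirr horth hdense b q hq rp hrp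
  -- `range q` is everything
  have hsurj : Function.Surjective q := by
    intro c
    obtain ⟨P, rfl⟩ := cl_surjective 𝒢 μ c
    obtain ⟨W, hWS, hW⟩ := exists_mem_areUnitarilyEquivalent_of_decomposition 𝒢 μ P hirr horth hdense
    exact ⟨⟨W, hWS⟩, (cl_eq_cl_iff 𝒢 μ _ _).2 hW⟩
  have hrange : Set.range q = Set.univ := Set.range_eq_univ.2 hsurj
  let e : Set.range q ≃ Cls 𝒢 μ := (Equiv.setCongr hrange).trans (Equiv.Set.univ (Cls 𝒢 μ))
  rw [← e.hasSum_iff] -- now a sum over `range q`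
  refine hsum.congr_fun fun c => ?_
  have hec : e c = (c : Cls 𝒢 μ) := rfl
  rw [Function.comp_apply, hec]
  -- the member `W := rp c ∈ S` of the class `↑c` (`q W = ↑c`) is unitarily equivalent to `rep ↑c`
  set W := rp c with hWdef
  have hWc : AreUnitarilyEquivalent (W : ClosedSubrep (𝒢.rightRegular μ)).toContRep (rep 𝒢 μ (c : Cls 𝒢 μ)).space.toContRep := by
    refine (cl_eq_cl_iff 𝒢 μ ⟨(W : ClosedSubrep (𝒢.rightRegular μ)), hirr W W.2⟩ (rep 𝒢 μ (c : Cls 𝒢 μ))).1 ?_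
    rw [cl_rep]
    exact hrp c
  -- multiplicity and class term are class functions
  rw [mult, multiplicity_congr_right (𝒢.rightRegular μ) hWc,
    tsum_inner_pairing_eq_trGp₀ 𝒢 μ ρ ν hρ g h F hF (c : Cls 𝒢 μ) W hWc (b W)]

end Block

/-! ## §4 The inner form `G′ = U(H)`, `H` anisotropic: `SpectralSideGp` at 𝔠₀ on the convolution span -/

section UnitaryGroup

open Literature.NumberTheory.Automorphic.UnitaryGroup
open Literature.AlgebraicGeometry.ShimuraVarieties (hermForm)
open scoped ComplexOrder

variable (L : Type) [Field L] [NumberField L] [IsCMField L] (N : ℕ) (H : Matrix (Fin N) (Fin N) L)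
  [MeasurableSpace (cmDatum L N H).Adelic] [BorelSpace (cmDatum L N H).Adelic]
  (μ : Measure (cmDatum L N H).automorphicQuotient) [(cmDatum L N H).IsAutomorphicMeasure μ]
  (ν : Measure (cmDatum L N H).Adelic) [ν.IsHaarMeasure] [ν.IsInvInvariant]

/-- **Law `SpectralSideGp` AT 𝔠₀ ON THE CONVOLUTION SPAN — «`T_{G′}(f′) = Σ_{π′} m(π′) tr π′(f′)`» for `G′ = U(H)`, `H` anisotropic**: for `F′ = g ⋆ h^*`,
`c ↦ mult₀ c · trGp₀ c F′` is summable over the classes of record and `θ_{G′}(F′) = UnitaryGroup.diagTrace … F′ = Σ' c, mult₀ c · trGp₀ c F′`.  The decomposition of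
`L²(U(H)(L⁺)∖U(H)(𝔸_{L⁺}), μ)` into irreducibles EXISTS (★ `isDiscretelyDecomposable_rightRegular_cmDatum`, ★ `exists_orthogonalDecomposition_of_isDiscretelyDecomposable`) and
§3 applies (counting measure on the discrete `U(H)(L⁺)`, as in ★ `UnitaryGroup.diagTrace`). [cite: Rogawski1990, §14.5 p. 237] [cite: Gelbart1975, (10.14)]
[cite: DeitmarEchterhoff2014, Thm. 9.2.2] -/
theorem spectralSideGp₀_of_conv (hanis : ∀ x : Fin N → L, hermForm (cmConjRingHom L) H x x = 0 → x = 0)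
    (g h F : C_c((cmDatum L N H).Adelic, ℂ)) (hF : ∀ x, F x = mulConv ν (⇑g) (mulStar (⇑h)) x) :
    Summable (fun c : Cls (cmDatum L N H) μ => (mult (cmDatum L N H) μ c : ℂ) * trGp₀ (cmDatum L N H) μ ν c F) ∧
      UnitaryGroup.diagTrace L N H μ ν hanis F = ∑' c : Cls (cmDatum L N H) μ, (mult (cmDatum L N H) μ c : ℂ) * trGp₀ (cmDatum L N H) μ ν c F := by
  haveI := compactSpace_cmDatum_automorphicQuotient L N H hanis
  haveI := isClosed_cmDatum_quotientSubgroup L N H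
  haveI := countable_cmDatum_quotientSubgroup L N H
  haveI := isFiniteMeasureOnCompacts_count_cmDatum_quotientSubgroup L N H
  obtain ⟨S, hirr, horth, hdense⟩ := ((cmDatum L N H).isUnitary_rightRegular μ).exists_orthogonalDecomposition_of_isDiscretelyDecomposable
    (isDiscretelyDecomposable_rightRegular_cmDatum L N H hanis μ)
  have hs := hasSum_mult_mul_trGp₀ (cmDatum L N H) μ (Measure.count : Measure (cmDatum L N H).quotientSubgroup) ν (NeZero.ne _) g h F hF
    hirr horth hdense
  rw [UnitaryGroup.diagTrace_eq]
  exact ⟨hs.summable, hs.tsum_eq.symm⟩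

/-- **The same in the frame of the letters line** (`N = 3`, `H` definite at the complex places off `ι`, `[L⁺:ℚ] ≥ 2` ⇒ anisotropic, ★ `anisotropic_of_frame`):
`SpectralSideGp` at 𝔠₀ for `F′ = g ⋆ h^*`, with `traceGp := UnitaryGroup.diagTrace L 3 H μ ν (anisotropic_of_frame L H ι hdef h2)` (T1 pin (i)∕(v)).
[cite: Rogawski1990, §14.5 p. 237] [cite: Gelbart1975, (10.14)] -/
theorem spectralSideGp₀_of_conv_of_frame (H : Matrix (Fin 3) (Fin 3) L) (ι : L →+* ℂ)
    [MeasurableSpace (cmDatum L 3 H).Adelic] [BorelSpace (cmDatum L 3 H).Adelic]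
    (hdef : ∀ τ' : L →+* ℂ, InfinitePlace.mk τ' ≠ InfinitePlace.mk ι → (H.map τ').PosDef)
    (h2 : 2 ≤ Module.finrank ℚ ↥(maximalRealSubfield L))
    (μ : Measure (cmDatum L 3 H).automorphicQuotient) [(cmDatum L 3 H).IsAutomorphicMeasure μ]
    (ν : Measure (cmDatum L 3 H).Adelic) [ν.IsHaarMeasure] [ν.IsInvInvariant]
    (g h F : C_c((cmDatum L 3 H).Adelic, ℂ)) (hF : ∀ x, F x = mulConv ν (⇑g) (mulStar (⇑h)) x) :
    Summable (fun c : Cls (cmDatum L 3 H) μ => (mult (cmDatum L 3 H) μ c : ℂ) * trGp₀ (cmDatum L 3 H) μ ν c F) ∧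
      UnitaryGroup.diagTrace L 3 H μ ν (F0P3ClassTokensOfRecord.anisotropic_of_frame L H ι hdef h2) F =
        ∑' c : Cls (cmDatum L 3 H) μ, (mult (cmDatum L 3 H) μ c : ℂ) * trGp₀ (cmDatum L 3 H) μ ν c F :=
  spectralSideGp₀_of_conv L 3 H μ ν (F0P3ClassTokensOfRecord.anisotropic_of_frame L H ι hdef h2) g h F hF

end UnitaryGroup

end Summit.HodgeConjecture.HodgeConjecture.Cruxes.H413.F0P3SpectralSideOfRecord

end
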